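/-
Literature anchor (engines group, cap lane, anchor #36): a kernel-checkable certificate for one
`C¹` validated integration step of a polynomial initial value problem with rational data — the
simultaneous state / variational high-order-enclosure test of Walawska–Wilczak 2016 §2.1
(`[ỹ] = ∑ [0,h]^i φ^[i](0,[x]) + [ε]`, `[Ṽ] = ∑ [0,h]^i ψ^[i](0,[x],Id) + [E]`, "check
simultaneously" `[0,h]^{m+1} φ^[m+1](0,[ỹ]) ⊂ [ε]` and `[0,h]^{m+1} ψ^[m+1](0,[ỹ],Id)[Ṽ] ⊂ [E]`)
carried out in exact rational interval arithmetic on sparse rational polynomials (Moore's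
recursion, formal Jacobians by `pderivQ`, natural interval extension, rational interval matrix
products), with a Boolean checker whose acceptance implies existence of the variational pair and
the enclosure of the state, of the solution `V(t)` of the variational equation and of the
derivative of the flow (soundness = `variationalEnclosure_step_intervalTest_smoothOn_local` /
`hasFDerivWithinAt_flow_intervalTest_smoothOn_local`); Moore's Volterra example (1979, §8.1
(8.6)) with its variational equation is replayed by `decide` in the kernel.
-/
import Literature.Analysis.ODE.VariationalEnclosureNaturalExtension
import Literature.Analysis.ODE.HighOrderEnclosureCertificate
import HarnessLib

/-!
# A kernel-checkable C¹ high-order enclosure step certificate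

Trunk T-ANA (Analysis/ODE); namespace `Literature.Analysis.ODE`.

`VariationalEnclosureIntervalTest.lean` proves the **`C¹` HOE step from box data**
(`variationalEnclosure_step_intervalTest_smoothOn_local`, Walawska–Wilczak 2016 §2.1 / §2.2
Lemma 2, Zgliczyński 2002): for `y' = f(y)`, `V' = Df(y) ∘ V`, boxes `Eⱼ ⊇ Φⱼ(W)`, `V ⊇ Φ_K(S)`,
interval matrices `EVⱼ ∋ Φⱼ'(x)` (`x ∈ W`), `AK ∋ Φ_K'(z)` (`z ∈ S`), `NN ⊇ AK · VV` and the two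
containments `∑_{j<K} [0,h]ʲ·Eⱼ + [0,h]^K·V ⊆ S`, `∑_{j<K} [0,h]ʲ·EVⱼ + [0,h]^K·NN ⊆ VV` give
existence of the variational pair from `(x, Id)` and the enclosure of EVERY solution pair — state
in `S` and in the Taylor tube, `V(t) ∈ VV` with its Taylor representation — and
(`hasFDerivWithinAt_flow_intervalTest_smoothOn_local`) the derivative of the flow within the box
of initial conditions.  `VariationalEnclosureNaturalExtension.lean` identifies, for a POLYNOMIAL
field, `Φⱼ = taylorMap p j` and `Φⱼ' = evalVecFDeriv (taylorPoly p j)` (the formal Jacobian of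
Moore's Taylor coefficient polynomials).  `HighOrderEnclosureCertificate.lean` made the state
half executable (`HOEStepCert`).  This file makes the **whole `C¹` test executable and checkable
by the Lean kernel** when the data are rational: the Jacobian data `EVⱼ`, `AK` are the natural
interval extensions of the partial-derivative term lists `pderivQ l (taylorQ P j i)`
(`SparsePolynomialEnclosure.lean`: exact differentiation `toMv_pderivQ` + Moore's Corollary 3.1
`eval_toMv_mem_encl`), the product `AK · VV` is a rational interval matrix product (Neumaier 1990
Proposition 3.1.2 (6), exact), and the two inclusion tests are decidable comparisons of rational
interval vectors / matrices.

## Contents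

* `castMat`, `imatmulQ` (+ `castMat_imatmulQ : castMat (imatmulQ A B) = imatmul (castMat A) (castMat B)`),
  `hoeMatBoxQ` (+ `castMat_hoeMatBoxQ`), `matLE` (+ `le_of_matLE`), `posBox`
  (+ `uniqueDiffOn_of_posBox`) — rational interval matrices, their product and matrix HOE box
  `∑_{j<K} Tʲ·EVⱼ + T^K·NN`, the decidable entrywise containment, non-degeneracy of a box.
* `jacEnclQ B q = (i,l) ↦ encl B (∂_l qᵢ)` — the natural interval extension of the formal Jacobian
  of a vector of term lists, with `pderiv_taylorPoly_fieldMv` and **`jacEntry_mem_jacEnclQ`**: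
  `(DΦⱼ(x))_{il} ∈ jacEnclQ B (taylorQ P j) i l` for `x` in the real box of `B`
  (Walawska–Wilczak's `ψ^[j](0,[B],Id)`, computed and sound).
* `VarStepCert n` — the certificate: field, order `K`, step `h`, initial box `W`, a-priori state
  box `S` and a-priori Jacobian box `VV = [Ṽ]`; `stateCheck` (= `HOEStepCert.check` of the state
  part, `toHOE_check`), **`check : Bool`** (state test ∧ `∑_{j<K} [0,h]ʲ·EVⱼ + [0,h]^K·(AK·VV) ⊆ VV`),
  **`VarStepCert.sound`**: `check = true` ⇒ for every `x ∈ W` the variational system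
  `y' = P(y)`, `V' = DP(y) ∘ V`, `y 0 = x`, `V 0 = Id` has a solution on `[0, h]` and EVERY
  solution pair `(z, J)` satisfies `z t ∈ S`, `z t = ∑_{j<K} tʲ Φⱼ(x) + t^K v` (`v ∈ remBox`),
  `J t ∈ VV` and `J t = ∑_{j<K} tʲ DΦⱼ(x) + t^K N` (`N ∈ jacRemBox = AK·VV`), entrywise;
  `jacEndBox = ∑_{j<K} [h,h]ʲ·EVⱼ + [h,h]^K·(AK·VV)` + **`mem_jacEndBox`** (`J(h) ∈ jacEndBox`:
  the interval matrix `J1 ∋ V(h)` handed to the rearrangement stage of a `C¹`-Lohner step);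
  `mem_endBox` (state end box, from `HOEStepCert.mem_endBox`);
  **`hasFDerivWithinAt_flow`** / **`hasFDerivWithinAt_flow_step`** (with `posBox S`: for ANY
  family of solutions from `W` staying in `S`, the flow map `x' ↦ u x' τ` has within the box `W`
  a derivative with entries in `VV`, and at `τ = h` in `jacEndBox` — `D_xφ(h, [W]) ⊆ J1`).
* `varStepVerifier` — the same packaged as a `ValidatedNumerics.Verifier` (instance = field,
  order, step, initial box; certificate = the pair of a-priori boxes `(S, VV)` found by any
  untrusted search; checker = `check`; claim = existence of the variational pair on `[0, h]`).
* **Moore's example with its variational equation, replayed in the kernel**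
  (`mooreVolterraVar`): Volterra's equations `x₁' = 2x₁(1 − x₂)`, `x₂' = −x₂(1 − x₁)`,
  `x(0) = (1, 3)`, `h = 0.125` (Moore 1979 §8.1 (8.6)–(8.8)), order 6, a-priori boxes
  `S = [0.4745, 1.1362] × [2.9012, 3.0204]` and `VV` (found by the untrusted stage by the usual
  inflate-and-retest iteration): `decide` accepts, whence the variational pair exists on
  `[0, 0.125]`, every solution `V` of `V' = Df(x(t))V`, `V(0) = Id` stays in `VV`, and
  `V(0.125) = D_xφ(0.125, (1,3))` lies in the certified interval matrix `jacEndBox ⊆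
  [0.5725, 0.6008] × [−0.1592, −0.1394] / [0.2781, 0.2907] × [0.9366, 0.9455]` (row-wise) — an
  honest but coarse enclosure: the remainder factor `AK = ψ^[6](0,[S],Id)` is evaluated in
  expanded monomial form over `S` (entries up to `±2.5·10³`), so the `[h,h]^6 · AK·VV` term
  dominates the widths (`≈ 0.03`); a non-validated RK4 integration of the variational system gives
  `D_xφ(0.125,(1,3)) ≈ ((0.58676, −0.14945), (0.28435, 0.94118))`, inside.

Everything computable is exact rational arithmetic (Moore 1966 §4.4); outward rounding may be
inserted in front of any box by inclusion isotonicity (`QMvPoly.encl_mono`, `imatmul_le_imatmul`,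
`hoeMatBox_le_hoeMatBox`) but is not needed for kernel replay.  No facts, no axioms, no `sorry`.
Deliberately NOT here: the QR / parallelepiped rearrangement of the propagated sets
(`LohnerDoubleton.lean` is the set algebra; its decidable rational form is a separate item), the
multi-step `C¹` chain (`VariationalEnclosureChain.lean` gives its soundness shape), and
non-polynomial fields.

## References

* I. Walawska, D. Wilczak, *An implicit algorithm for validated enclosures of the solutions to
  variational equations for ODEs*, Appl. Math. Comput. 291 (2016) 303–322 (arXiv:1509.07388):
  §1.2 (`ψ(t,x,V) = D_xφ(t,x)·V`, Taylor coefficients `φ^[i]`, `ψ^[i]`), §2 (the step structure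
  `[x_k],[V_k] ↦ [x_{k+1}],[V_{k+1}]`, rough enclosures (3)–(4)), §2.1 (the predictors for
  `[ỹ]`, `[Ṽ]` and the two tests "checked simultaneously"), §2.2 Lemma 2.
  [held: lit key paper:arxiv-1509.07388, p. 5 lines 74–110] [WalawskaWilczak2016]
* P. Zgliczyński, *C¹ Lohner algorithm*, Found. Comput. Math. 2 (2002) 429–465 (the `C¹`
  rough enclosure `W₃ ⊇ V([0,h])` and the interval matrix `J1 ∋ ∂φ/∂x(h,[x])` passed to the
  rearrangement). [Zgliczynski2002C1Lohner]
* R. E. Moore, *Methods and Applications of Interval Analysis*, SIAM 1979: §3.3 Corollary 3.1,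
  §3.4 (3.13)–(3.18), §3.5 (3.31), §8.1 (8.6)–(8.13). [held: lit key
  book:moorend-methods-applications-interval-analysis, pp. 23–27, 80–84] [Moore1979]
* A. Neumaier, *Interval Methods for Systems of Equations*, Cambridge UP 1990, §3.1
  Proposition 3.1.2 (6)–(7) (interval matrix product: inclusion property and isotonicity).
  [Neumaier1991]
* N. S. Nedialkov, K. R. Jackson, J. D. Pryce, *An effective high-order interval method for
  validating existence and uniqueness of the solution of an IVP for an ODE*, Reliable Computing 7
  (2001), §3. [NedialkovJacksonPryce2001]
* N. S. Nedialkov, K. R. Jackson, G. F. Corliss, *Validated solutions of initial value problems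
  for ordinary differential equations*, Appl. Math. Comput. 105 (1999), §5 Algorithm I (guess the
  a-priori enclosure, then validate). [NedialkovJacksonCorliss1999]
* R. E. Moore, *Interval Analysis*, Prentice-Hall 1966, §4.4 (exact rational interval arithmetic
  as the machine model of a checker). [Moore1966]
-/

open Set NonemptyInterval
open Literature.Analysis.ValidatedNumerics

namespace Literature.Analysis.ODE

/-! ### Rational interval matrices -/

section RatMatrices

variable {n : ℕ}

/-- The real interval matrix represented by a matrix of rational intervals (row `i` is the
`castBox` of row `i`). [cite: Neumaier1991, §3.1 (A = [inf A, sup A])] -/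
noncomputable def castMat (A : Fin n → Fin n → NonemptyInterval ℚ) :
    Fin n → Fin n → NonemptyInterval ℝ :=
  fun i => castBox (A i)

/-- Entries of `castMat`. [cite: Neumaier1991, §3.1 (A = [inf A, sup A])] -/
@[simp] theorem castMat_apply (A : Fin n → Fin n → NonemptyInterval ℚ) (i l : Fin n) :
    castMat A i l = (A i l).ratCast ℝ := rfl

/-- `castMat` is inclusion monotonic. [cite: Neumaier1991, §3.1 Proposition 3.1.2 (7)] -/
theorem castMat_mono {A B : Fin n → Fin n → NonemptyInterval ℚ} (h : A ≤ B) :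
    castMat A ≤ castMat B :=
  fun i => castBox_mono (h i)

/-- Casting commutes with exact sums of lists of rational intervals. [cite: Moore1966, Ch. 2] -/
theorem ratCast_listSum (l : List (NonemptyInterval ℚ)) :
    (l.sum).ratCast ℝ = (l.map (ratCast ℝ)).sum := by
  induction l with
  | nil => simp only [List.sum_nil, List.map_nil, QMvPoly.ratCast_zero]
  | cons a l ih => rw [List.sum_cons, List.map_cons, List.sum_cons, QMvPoly.ratCast_add, ih]

/-- The **rational interval matrix product** `(AB)_{il} = ∑_k A_{ik} · B_{kl}` (scalar Moore
products, exact interval sums over the list of indices — structurally recursive, so that the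
kernel can evaluate it). [cite: Neumaier1991, §3.1 Proposition 3.1.2 (6)] -/
def imatmulQ (A B : Fin n → Fin n → NonemptyInterval ℚ) : Fin n → Fin n → NonemptyInterval ℚ :=
  fun i l => ((List.finRange n).map fun k => (A i k).mooreMul (B k l)).sum

/-- **The rational interval matrix product represents the real one**:
`castMat (imatmulQ A B) = imatmul (castMat A) (castMat B)` (`imatmul` of
`VariationalEnclosureIntervalTest.lean`), so Neumaier's inclusion property `matmul_mem_imatmul`
and isotonicity `imatmul_le_imatmul` apply to the computed product.
[cite: Neumaier1991, §3.1 Proposition 3.1.2 (6)–(7)] -/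
theorem castMat_imatmulQ (A B : Fin n → Fin n → NonemptyInterval ℚ) :
    castMat (imatmulQ A B) = imatmul (castMat A) (castMat B) := by
  funext i l
  simp only [castMat, castBox_apply, imatmulQ, imatmul]
  rw [ratCast_listSum, List.map_map, Fin.sum_univ_def]
  congr 1
  refine List.map_congr_left fun k _ => ?_
  simp only [Function.comp_apply, ratCast_mooreMul]

/-- The **rational matrix HOE box** `∑_{j<K} Tʲ · EVⱼ + T^K · NN` (row `i` is the rational HOE
box `hoeBoxQ` of the rows of the data) — Walawska–Wilczak's predictor
`[Ṽ] = ∑_{i≤m} [0,h]^i ψ^[i](0,[x_k],Id) + [E]` in exact rational interval arithmetic.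
[cite: WalawskaWilczak2016, §2.1 (C¹ high-order enclosure)] [cite: Moore1979, §3.5 eq. (3.31)] -/
def hoeMatBoxQ (T : NonemptyInterval ℚ) (EV : ℕ → Fin n → Fin n → NonemptyInterval ℚ)
    (NN : Fin n → Fin n → NonemptyInterval ℚ) (K : ℕ) : Fin n → Fin n → NonemptyInterval ℚ :=
  fun i => hoeBoxQ T (fun j => EV j i) (NN i) K

/-- **The rational matrix HOE box represents the real one**: `castMat (hoeMatBoxQ T EV NN K)` is
the `hoeMatBox` of `VariationalEnclosureIntervalTest.lean` of the cast data.
[cite: WalawskaWilczak2016, §2.1 (C¹ high-order enclosure)] [cite: Moore1979, §3.5 eq. (3.31)] -/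
theorem castMat_hoeMatBoxQ (T : NonemptyInterval ℚ) (EV : ℕ → Fin n → Fin n → NonemptyInterval ℚ)
    (NN : Fin n → Fin n → NonemptyInterval ℚ) (K : ℕ) :
    castMat (hoeMatBoxQ T EV NN K) =
      hoeMatBox (T.ratCast ℝ) (fun j => castMat (EV j)) (castMat NN) K := by
  funext i
  exact castBox_hoeBoxQ T (fun j => EV j i) (NN i) K

/-- **Decidable containment of rational interval matrices** `A ⊆ B` (entrywise, row by row via
`boxLE`) — the comparison in the `C¹` test `[0,h]^{m+1} ψ^[m+1](0,[ỹ],Id)[Ṽ] ⊂ [E]`, i.e.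
`∑ [0,h]ʲ·EVⱼ + [0,h]^K·NN ⊆ VV`. [cite: WalawskaWilczak2016, §2.1 (C¹ high-order enclosure)] -/
def matLE (A B : Fin n → Fin n → NonemptyInterval ℚ) : Bool :=
  (List.finRange n).all fun i => boxLE (A i) (B i)

/-- `matLE A B = true` means `A ≤ B` entrywise. [cite: WalawskaWilczak2016, §2.1 (C¹ high-order enclosure)] -/
theorem le_of_matLE {A B : Fin n → Fin n → NonemptyInterval ℚ} (h : matLE A B = true) : A ≤ B :=
  fun i => le_of_boxLE (List.all_eq_true.1 h i (List.mem_finRange i))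

/-- **Decidable non-degeneracy of a rational box**: every component interval has positive width
(so the real box has non-empty interior and derivatives within it are unique).
[cite: Neumaier1991, §3.1 (int A)] -/
def posBox (S : Fin n → NonemptyInterval ℚ) : Bool :=
  (List.finRange n).all fun i => decide ((S i).fst < (S i).snd)

/-- A box accepted by `posBox` is a set of unique differentiability (`uniqueDiffOn_boxSet`).
[cite: Neumaier1991, §3.1 (int A)] -/
theorem uniqueDiffOn_of_posBox {S : Fin n → NonemptyInterval ℚ} (h : posBox S = true) :
    UniqueDiffOn ℝ (boxSet (castBox S)) := by
  refine uniqueDiffOn_boxSet fun i => ?_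
  have hi : (S i).fst < (S i).snd :=
    of_decide_eq_true (List.all_eq_true.1 h i (List.mem_finRange i))
  rw [castBox_apply, fst_ratCast, snd_ratCast]
  exact_mod_cast hi

end RatMatrices

/-! ### Natural interval extension of the formal Jacobian of term lists -/

section Jacobian

variable {n : ℕ}

/-- The **natural interval extension of the formal Jacobian** of a vector of term lists over a
rational box: the rational interval matrix `(i, l) ↦ encl B (∂_l qᵢ)` (exact partial derivative
`pderivQ`, then Moore's natural extension in monomial form) — for `q = taylorQ P j` this is the
machine's `ψ^[j](0, [B], Id)`. [cite: WalawskaWilczak2016, §2.1 (C¹ high-order enclosure)]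
[cite: Moore1979, §3.3 Corollary 3.1] -/
def jacEnclQ (B : Fin n → NonemptyInterval ℚ) (q : Fin n → QMvPoly) :
    Fin n → Fin n → NonemptyInterval ℚ :=
  fun i l => QMvPoly.encl B (QMvPoly.pderivQ l (q i))

/-- Inclusion monotonicity of the Jacobian extension (an outward-rounded box may replace the
exact one). [cite: Moore1979, §3.2 eqs. (3.4)–(3.5)] -/
theorem jacEnclQ_mono {B B' : Fin n → NonemptyInterval ℚ} (h : ∀ i, B i ≤ B' i)
    (q : Fin n → QMvPoly) : jacEnclQ B q ≤ jacEnclQ B' q :=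
  fun i l => QMvPoly.encl_mono h (QMvPoly.pderivQ l (q i))

/-- **The partial derivatives of the Taylor coefficient polynomials are computed exactly on term
lists**: `∂_l (taylorPoly (fieldMv P) j)_i` is the polynomial denoted by
`pderivQ l (taylorQ P j i)` (Moore's recursion, then formal differentiation).
[cite: WalawskaWilczak2016, §1.2 (ψ = D_xφ·V, Taylor coefficients φ^[i], ψ^[i])]
[cite: HairerWannerLubich2002, §III.5.1 eq. (5.2)] -/
theorem pderiv_taylorPoly_fieldMv (P : Fin n → QMvPoly) (j : ℕ) (i l : Fin n) :
    MvPolynomial.pderiv l (taylorPoly (fieldMv P) j i) =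
      QMvPoly.toMv ℝ n (QMvPoly.pderivQ l (taylorQ P j i)) := by
  rw [QMvPoly.toMv_pderivQ, toMv_taylorQ]
  rfl

/-- **The Jacobian enclosures `EVⱼ`, `AK` of the `C¹` test, computed and sound**: for `x` in the
real box of `B`, the entry `(DΦⱼ(x))_{il} = (∂_l (taylorPoly (fieldMv P) j)_i)(x)` of the Jacobian
of the `j`-th Taylor coefficient map lies in `jacEnclQ B (taylorQ P j) i l` (Moore 1979 Corollary
3.1 applied to the differentiated recursion; Walawska–Wilczak's `ψ^[j](0,[B],Id) ∋ ψ^[j](0,x,Id)`).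
[cite: Moore1979, §3.3 Corollary 3.1] [cite: WalawskaWilczak2016, §2.1 (C¹ high-order enclosure)] -/
theorem jacEntry_mem_jacEnclQ (P : Fin n → QMvPoly) (j : ℕ) (B : Fin n → NonemptyInterval ℚ)
    {x : Fin n → ℝ} (hx : x ∈ boxSet (castBox B)) (i l : Fin n) :
    evalVecFDeriv (taylorPoly (fieldMv P) j) x (Pi.single l 1) i ∈
      (jacEnclQ B (taylorQ P j) i l).ratCast ℝ := by
  rw [evalVecFDeriv_single, pderiv_taylorPoly_fieldMv]
  exact QMvPoly.eval_toMv_mem_encl (mem_boxSet_iff.1 hx) _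

/-- Matrix form of `jacEntry_mem_jacEnclQ`: the entries of `DΦⱼ(x)` lie in `castMat (jacEnclQ B
(taylorQ P j))`. [cite: Moore1979, §3.3 Corollary 3.1] -/
theorem jacEntry_mem_castMat_jacEnclQ (P : Fin n → QMvPoly) (j : ℕ) (B : Fin n → NonemptyInterval ℚ)
    {x : Fin n → ℝ} (hx : x ∈ boxSet (castBox B)) (i l : Fin n) :
    evalVecFDeriv (taylorPoly (fieldMv P) j) x (Pi.single l 1) i ∈
      castMat (jacEnclQ B (taylorQ P j)) i l :=
  jacEntry_mem_jacEnclQ P j B hx i l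

end Jacobian

/-! ### The C¹ certificate and its soundness -/

/-- A **`C¹` high-order enclosure step certificate** for a polynomial initial value problem with
rational data: the field `y' = P(y)` as term lists, the order `K`, the step `h`, the initial box
`W`, the claimed a-priori state enclosure `S ⊇ y([0, h])` and the claimed a-priori Jacobian
enclosure `VV = [Ṽ] ⊇ V([0, h])` of the solution of the variational equation `V' = DP(y) V`,
`V(0) = Id` (the two rough enclosures (3)–(4) of Walawska–Wilczak 2016 §2, found by the untrusted
stage). [cite: WalawskaWilczak2016, §2 (step structure [x_k],[V_k] ↦ [x_{k+1}],[V_{k+1}]) and §2.1]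
[cite: NedialkovJacksonCorliss1999, §5 Algorithm I] -/
structure VarStepCert (n : ℕ) where
  /-- The polynomial vector field, one term list per component. -/
  field : Fin n → QMvPoly
  /-- The order `K ≥ 1` of the Taylor expansions (remainder terms of degree `K`). -/
  order : ℕ
  /-- The step size `h ≥ 0`. -/
  step : ℚ
  /-- The box `W` of initial values. -/
  init : Fin n → NonemptyInterval ℚ
  /-- The claimed a-priori enclosure `S` of the state over the whole step. -/
  apriori : Fin n → NonemptyInterval ℚ
  /-- The claimed a-priori enclosure `VV = [Ṽ]` of the Jacobian `V(t)` over the whole step. -/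
  jacApriori : Fin n → Fin n → NonemptyInterval ℚ

namespace VarStepCert

variable {n : ℕ} (c : VarStepCert n)

/-- The state part of the certificate, as an `HOEStepCert`. [cite: Moore1979, §8.1 eqs. (8.5), (8.10), (8.13)] -/
def toHOE : HOEStepCert n :=
  ⟨c.field, c.order, c.step, c.init, c.apriori⟩

/-- The coefficient boxes `Eⱼ = enclVec W (x)ⱼ ⊇ Φⱼ(W)`. [cite: Moore1979, §8.1 eqs. (8.9)–(8.10)] -/
def coeffBox (j : ℕ) : Fin n → NonemptyInterval ℚ :=
  QMvPoly.enclVec c.init (taylorQ c.field j)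

/-- The remainder box `V = enclVec S (x)_K ⊇ Φ_K(S)`. [cite: Moore1979, §8.1 eqs. (8.9)–(8.12)] -/
def remBox : Fin n → NonemptyInterval ℚ :=
  QMvPoly.enclVec c.apriori (taylorQ c.field c.order)

/-- The Jacobian coefficient matrices `EVⱼ = ψ^[j](0,[W],Id) ∋ DΦⱼ(x)` (`x ∈ W`).
[cite: WalawskaWilczak2016, §2.1 (C¹ high-order enclosure)] -/
def jacCoeffBox (j : ℕ) : Fin n → Fin n → NonemptyInterval ℚ :=
  jacEnclQ c.init (taylorQ c.field j)

/-- The Jacobian remainder factor `AK = ψ^[K](0,[S],Id) ∋ DΦ_K(z)` (`z ∈ S`).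
[cite: WalawskaWilczak2016, §2.1 (C¹ high-order enclosure)] -/
def jacRemFactor : Fin n → Fin n → NonemptyInterval ℚ :=
  jacEnclQ c.apriori (taylorQ c.field c.order)

/-- The Jacobian remainder matrix `NN = AK · VV = ψ^[K](0,[S],Id)[Ṽ]` (rational interval matrix
product). [cite: WalawskaWilczak2016, §2.1 (C¹ high-order enclosure)]
[cite: Neumaier1991, §3.1 Proposition 3.1.2 (6)] -/
def jacRemBox : Fin n → Fin n → NonemptyInterval ℚ :=
  imatmulQ c.jacRemFactor c.jacApriori

/-- The state test: `K ≥ 1`, `h ≥ 0`, `∑_{j<K} [0,h]ʲ·Eⱼ + [0,h]^K·V ⊆ S`.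
[cite: Moore1979, §8.1 eq. (8.10) with (8.13)] [cite: NedialkovJacksonPryce2001, §3 (HOE existence test)] -/
def stateCheck : Bool :=
  decide (0 < c.order) && decide (0 ≤ c.step) &&
    boxLE (hoeBoxQ (stepIv c.step) c.coeffBox c.remBox c.order) c.apriori

/-- The state test is the `HOEStepCert.check` of the state part. [cite: Moore1979, §8.1 eq. (8.10)] -/
theorem toHOE_check : c.toHOE.check = c.stateCheck := rfl

/-- **The checker**: the state HOE test and the `C¹` test
`∑_{j<K} [0,h]ʲ·EVⱼ + [0,h]^K·(AK·VV) ⊆ VV`, "checked simultaneously", in exact rational interval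
arithmetic. [cite: WalawskaWilczak2016, §2.1 (C¹ high-order enclosure)]
[cite: NedialkovJacksonPryce2001, §3 (HOE existence test)] -/
def check : Bool :=
  c.stateCheck &&
    matLE (hoeMatBoxQ (stepIv c.step) c.jacCoeffBox c.jacRemBox c.order) c.jacApriori

/-- The **Jacobian end box** `J1 = ∑_{j<K} [h,h]ʲ·EVⱼ + [h,h]^K·(AK·VV) ∋ V(h) = D_xφ(h, x)` —
the interval matrix a `C¹`-Lohner step hands to its rearrangement stage and to the next step.
[cite: Zgliczynski2002C1Lohner, §3 (C¹-Lohner algorithm: the enclosure of ∂φ/∂x(h,[x]))]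
[cite: WalawskaWilczak2016, §2 (step structure [x_k],[V_k] ↦ [x_{k+1}],[V_{k+1}])] -/
def jacEndBox : Fin n → Fin n → NonemptyInterval ℚ :=
  hoeMatBoxQ (pure c.step) c.jacCoeffBox c.jacRemBox c.order

variable {c}

/-- What an accepted certificate establishes about the real data: `0 < K`, `0 ≤ h`, the real state
HOE test and the real `C¹` test `hoeMatBox [0,h] EV (AK·VV) K ≤ VV`.
[cite: WalawskaWilczak2016, §2.1 (C¹ high-order enclosure)] [cite: Moore1979, §8.1 eq. (8.10)] -/
theorem check_spec (hc : c.check = true) :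
    0 < c.order ∧ (0 : ℝ) ≤ (c.step : ℝ) ∧
      hoeBox ((stepIv c.step).ratCast ℝ) (fun j => castBox (c.coeffBox j)) (castBox c.remBox)
          c.order ≤ castBox c.apriori ∧
      hoeMatBox ((stepIv c.step).ratCast ℝ) (fun j => castMat (c.jacCoeffBox j))
          (castMat c.jacRemBox) c.order ≤ castMat c.jacApriori := by
  simp only [check, Bool.and_eq_true] at hc
  have h1 : c.toHOE.check = true := by rw [toHOE_check]; exact hc.1
  obtain ⟨hK, hh, htest⟩ := HOEStepCert.check_spec h1
  refine ⟨hK, hh, htest, ?_⟩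
  have htestV := castMat_mono (le_of_matLE hc.2)
  rw [castMat_hoeMatBoxQ] at htestV
  exact htestV

/-- The real interval product hypothesis `imatmul AK VV ≤ NN` holds with equality for the
computed `NN = imatmulQ AK VV`. [cite: Neumaier1991, §3.1 Proposition 3.1.2 (6)] -/
theorem imatmul_le_jacRemBox :
    imatmul (castMat c.jacRemFactor) (castMat c.jacApriori) ≤ castMat c.jacRemBox := by
  rw [jacRemBox, castMat_imatmulQ]

/-- **Soundness of the `C¹` step certificate** (Walawska–Wilczak 2016 §2.1 / §2.2 Lemma 2 for
`y' = P(y)`; Zgliczyński 2002).  If `check` accepts, then for every real initial value `x` in the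
box `W`: the variational system `y' = P(y)`, `V' = DP(y) ∘ V`, `y(0) = x`, `V(0) = Id` has a
solution on `[0, h]`, and EVERY solution pair `(z, J)` satisfies for all `t ∈ [0, h]`:
`z t ∈ S`, `z t = ∑_{j<K} tʲ Φⱼ(x) + t^K v` with `v ∈ remBox` (`Φⱼ = taylorMap`), `J t ∈ VV` and
`J t = ∑_{j<K} tʲ DΦⱼ(x) + t^K N` with `N ∈ jacRemBox = AK·VV` (`DΦⱼ(x) = evalVecFDeriv
(taylorPoly · j) x`), entrywise — `variationalEnclosure_step_intervalTest_smoothOn_local` with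
every box hypothesis discharged by computation.
[cite: WalawskaWilczak2016, §2.1 (C¹ high-order enclosure) and §2.2 Lemma 2]
[cite: Zgliczynski2002C1Lohner, §3 (C¹-Lohner algorithm: the enclosure of ∂φ/∂x(h,[x]))]
[cite: Moore1979, §8.1 eqs. (8.10), (8.13)] -/
theorem sound (hc : c.check = true) {x : Fin n → ℝ} (hx : x ∈ boxSet (castBox c.init)) :
    (∃ y : ℝ → Fin n → ℝ, ∃ V' : ℝ → (Fin n → ℝ) →L[ℝ] (Fin n → ℝ), y 0 = x ∧ V' 0 = 1 ∧
      (∀ t ∈ Icc 0 (c.step : ℝ),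
        HasDerivWithinAt y (evalVec (fieldMv c.field) (y t)) (Icc 0 (c.step : ℝ)) t) ∧
      ∀ t ∈ Icc 0 (c.step : ℝ),
        HasDerivWithinAt V' ((evalVecFDeriv (fieldMv c.field) (y t)).comp (V' t))
          (Icc 0 (c.step : ℝ)) t) ∧
    ∀ (z : ℝ → Fin n → ℝ) (J : ℝ → (Fin n → ℝ) →L[ℝ] (Fin n → ℝ)), z 0 = x → J 0 = 1 →
      (∀ t ∈ Icc 0 (c.step : ℝ),
        HasDerivWithinAt z (evalVec (fieldMv c.field) (z t)) (Icc 0 (c.step : ℝ)) t) →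
      (∀ t ∈ Icc 0 (c.step : ℝ),
        HasDerivWithinAt J ((evalVecFDeriv (fieldMv c.field) (z t)).comp (J t))
          (Icc 0 (c.step : ℝ)) t) →
      ∀ t ∈ Icc 0 (c.step : ℝ),
        (z t ∈ boxSet (castBox c.apriori) ∧ ∃ v ∈ boxSet (castBox c.remBox),
          z t = (∑ j ∈ Finset.range c.order, t ^ j • taylorMap (fieldMv c.field) j x) +
            t ^ c.order • v) ∧
        (∀ i l, J t (Pi.single l 1) i ∈ castMat c.jacApriori i l) ∧
        ∃ N : (Fin n → ℝ) →L[ℝ] (Fin n → ℝ), (∀ i l, N (Pi.single l 1) i ∈ castMat c.jacRemBox i l) ∧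
          J t = (∑ j ∈ Finset.range c.order,
              t ^ j • evalVecFDeriv (taylorPoly (fieldMv c.field) j) x) + t ^ c.order • N := by
  obtain ⟨hK, hh, htest, htestV⟩ := check_spec hc
  have hf := contDiffOn_evalVec_top (fieldMv c.field)
  have hE' : ∀ j < c.order, MapsTo (smoothTaylorMap hf j) (boxSet (castBox c.init))
      (boxSet (castBox (c.coeffBox j))) := fun j _ => by
    rw [smoothTaylorMap_polynomial]
    exact mapsTo_taylorMap_enclVec c.field j c.init
  have hV' : MapsTo (smoothTaylorMap hf c.order) (boxSet (castBox c.apriori))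
      (boxSet (castBox c.remBox)) := by
    rw [smoothTaylorMap_polynomial]
    exact mapsTo_taylorMap_enclVec c.field c.order c.apriori
  have hEV' : ∀ j < c.order, ∀ x ∈ boxSet (castBox c.init), ∀ i l,
      smoothTaylorFDeriv hf j x (Pi.single l 1) i ∈ castMat (c.jacCoeffBox j) i l :=
    fun j _ x hx i l => by
    rw [smoothTaylorFDeriv_polynomial]
    exact jacEntry_mem_castMat_jacEnclQ c.field j c.init hx i l
  have hAK' : ∀ z ∈ boxSet (castBox c.apriori), ∀ i l,
      smoothTaylorFDeriv hf c.order z (Pi.single l 1) i ∈ castMat c.jacRemFactor i l :=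
    fun z hz i l => by
    rw [smoothTaylorFDeriv_polynomial]
    exact jacEntry_mem_castMat_jacEnclQ c.field c.order c.apriori hz i l
  have hmain := variationalEnclosure_step_intervalTest_smoothOn_local hf hK hh
    (fun t ht => mem_ratCast_stepIv ht) (castBox c.init) (castBox c.apriori) (castBox c.remBox)
    (fun j => castBox (c.coeffBox j)) (fun j => castMat (c.jacCoeffBox j))
    (castMat c.jacRemFactor) (castMat c.jacApriori) (castMat c.jacRemBox) (fun _ _ => trivial)
    hE' hV' htest hEV' hAK' imatmul_le_jacRemBox htestV hx
  simpa only [smoothTaylorMap_polynomial, smoothTaylorFDeriv_polynomial, fderiv_evalVec]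
    using hmain

/-- **The certified state end box** (the state half is an accepted `HOEStepCert`): every solution
from `y₀ ∈ W` satisfies `z(h) ∈ toHOE.endBox`. [cite: Moore1979, §8.1 eq. (8.10)]
[cite: NedialkovJacksonCorliss1999, §5 Algorithm I] -/
theorem mem_endBox (hc : c.check = true) {x : Fin n → ℝ} (hx : x ∈ boxSet (castBox c.init))
    {z : ℝ → Fin n → ℝ} (hz0 : z 0 = x)
    (hz : ∀ t ∈ Icc 0 (c.step : ℝ),
      HasDerivWithinAt z (evalVec (fieldMv c.field) (z t)) (Icc 0 (c.step : ℝ)) t) :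
    z c.step ∈ boxSet (castBox c.toHOE.endBox) := by
  simp only [check, Bool.and_eq_true] at hc
  have h1 : c.toHOE.check = true := by rw [toHOE_check]; exact hc.1
  exact HOEStepCert.mem_endBox h1 hx hz0 hz

/-- The entries of a Jacobian Taylor sum `∑_{k<K} t^k Φₖ' + t^K N` are the Taylor sums of the
entries. [folklore] -/
private theorem taylorSum_apply_single' (Φ' : ℕ → (Fin n → ℝ) →L[ℝ] (Fin n → ℝ))
    (N : (Fin n → ℝ) →L[ℝ] (Fin n → ℝ)) (K : ℕ) (t : ℝ) :
    (fun i j => ((∑ k ∈ Finset.range K, t ^ k • Φ' k) + t ^ K • N) (Pi.single j 1) i) =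
      (∑ k ∈ Finset.range K, t ^ k • fun i j => Φ' k (Pi.single j 1) i) +
        t ^ K • fun i j => N (Pi.single j 1) i := by
  ext i j
  simp only [_root_.add_apply, _root_.sum_apply, _root_.smul_apply, Finset.sum_apply,
    Pi.smul_apply, Pi.add_apply, smul_eq_mul]

/-- `castMat jacEndBox` is the real matrix HOE box at the point interval `[h, h]`.
[cite: WalawskaWilczak2016, §2 (step structure [x_k],[V_k] ↦ [x_{k+1}],[V_{k+1}])] -/
theorem castMat_jacEndBox :
    castMat c.jacEndBox =
      hoeMatBox (pure (c.step : ℝ)) (fun j => castMat (c.jacCoeffBox j)) (castMat c.jacRemBox)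
        c.order := by
  rw [jacEndBox, castMat_hoeMatBoxQ, ratCast_pure]

/-- **The certified Jacobian end box**: if `check` accepts, every solution pair `(z, J)` from
`(x, Id)`, `x ∈ W`, satisfies `J(h) ∈ jacEndBox` entrywise — the interval matrix
`J1 ∋ V(h) = D_xφ(h, x)` of the `C¹`-Lohner algorithm (Zgliczyński 2002), obtained from the
Taylor representation of `J(h)` given by `sound` and Moore's inclusion property of the interval
polynomial. [cite: Zgliczynski2002C1Lohner, §3 (C¹-Lohner algorithm: the enclosure of ∂φ/∂x(h,[x]))]
[cite: Moore1979, §3.3 Theorem 3.1 and §3.5 eq. (3.31)] -/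
theorem mem_jacEndBox (hc : c.check = true) {x : Fin n → ℝ} (hx : x ∈ boxSet (castBox c.init))
    {z : ℝ → Fin n → ℝ} {J : ℝ → (Fin n → ℝ) →L[ℝ] (Fin n → ℝ)} (hz0 : z 0 = x) (hJ0 : J 0 = 1)
    (hz : ∀ t ∈ Icc 0 (c.step : ℝ),
      HasDerivWithinAt z (evalVec (fieldMv c.field) (z t)) (Icc 0 (c.step : ℝ)) t)
    (hJ : ∀ t ∈ Icc 0 (c.step : ℝ),
      HasDerivWithinAt J ((evalVecFDeriv (fieldMv c.field) (z t)).comp (J t))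
        (Icc 0 (c.step : ℝ)) t) :
    ∀ i l, J c.step (Pi.single l 1) i ∈ castMat c.jacEndBox i l := by
  obtain ⟨hK, hh, -, -⟩ := check_spec hc
  obtain ⟨-, henc⟩ := sound hc hx
  obtain ⟨-, -, N, hN, hJt⟩ := henc z J hz0 hJ0 hz hJ (c.step : ℝ) ⟨hh, le_rfl⟩
  have hmem := jacTaylorSum_mem_hoeMatBox (EV := fun j => castMat (c.jacCoeffBox j))
    (NN := castMat c.jacRemBox) (K := c.order) (mem_pure_self (c.step : ℝ))
    (e := fun j => fun i l => evalVecFDeriv (taylorPoly (fieldMv c.field) j) x (Pi.single l 1) i)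
    (fun j _ => (mem_matBoxSet_iff (A := castMat (c.jacCoeffBox j))).2 fun i l =>
      jacEntry_mem_castMat_jacEnclQ c.field j c.init hx i l)
    ((mem_matBoxSet_iff (A := castMat c.jacRemBox)).2 hN)
  rw [← taylorSum_apply_single', ← hJt, ← castMat_jacEndBox] at hmem
  exact (mem_matBoxSet_iff (A := castMat c.jacEndBox)).1 hmem

/-- **The derivative of the flow from an accepted certificate** (Walawska–Wilczak 2016 §1.2
`ψ(t,x,Id) = D_xφ(t,x)`; Zgliczyński 2002).  If `check` accepts and the a-priori box `S` is
non-degenerate (`posBox`), then for ANY family `u` of solutions of `y' = P(y)` on `[0, h]` from the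
points of `W` staying in `S`, every `x ∈ W` and `τ ∈ [0, h]`: the flow map `x' ↦ u x' τ` has within
the box `W` at `x` a derivative `J` with entries in `VV`, `J = ∑_{j<K} τʲ DΦⱼ(x) + τ^K N`,
`N ∈ AK·VV`. [cite: WalawskaWilczak2016, §1.2 (ψ = D_xφ·V) and §2.2 Lemma 2]
[cite: Zgliczynski2002C1Lohner, §3 (C¹-Lohner algorithm: the enclosure of ∂φ/∂x(h,[x]))] -/
theorem hasFDerivWithinAt_flow (hc : c.check = true) (hS : posBox c.apriori = true)
    {u : (Fin n → ℝ) → ℝ → Fin n → ℝ}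
    (hu : IsSolutionFamily (evalVec (fieldMv c.field)) (boxSet (castBox c.apriori))
      (boxSet (castBox c.init)) (c.step : ℝ) u)
    {x : Fin n → ℝ} (hx : x ∈ boxSet (castBox c.init)) {τ : ℝ} (hτ : τ ∈ Icc 0 (c.step : ℝ)) :
    ∃ J : (Fin n → ℝ) →L[ℝ] (Fin n → ℝ),
      HasFDerivWithinAt (fun x' => u x' τ) J (boxSet (castBox c.init)) x ∧
      (∀ i l, J (Pi.single l 1) i ∈ castMat c.jacApriori i l) ∧
      ∃ N : (Fin n → ℝ) →L[ℝ] (Fin n → ℝ), (∀ i l, N (Pi.single l 1) i ∈ castMat c.jacRemBox i l) ∧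
        J = (∑ j ∈ Finset.range c.order,
            τ ^ j • evalVecFDeriv (taylorPoly (fieldMv c.field) j) x) + τ ^ c.order • N := by
  obtain ⟨hK, hh, htest, htestV⟩ := check_spec hc
  have hf := contDiffOn_evalVec_top (fieldMv c.field)
  have hE' : ∀ j < c.order, MapsTo (smoothTaylorMap hf j) (boxSet (castBox c.init))
      (boxSet (castBox (c.coeffBox j))) := fun j _ => by
    rw [smoothTaylorMap_polynomial]
    exact mapsTo_taylorMap_enclVec c.field j c.init
  have hV' : MapsTo (smoothTaylorMap hf c.order) (boxSet (castBox c.apriori))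
      (boxSet (castBox c.remBox)) := by
    rw [smoothTaylorMap_polynomial]
    exact mapsTo_taylorMap_enclVec c.field c.order c.apriori
  have hEV' : ∀ j < c.order, ∀ x ∈ boxSet (castBox c.init), ∀ i l,
      smoothTaylorFDeriv hf j x (Pi.single l 1) i ∈ castMat (c.jacCoeffBox j) i l :=
    fun j _ x hx i l => by
    rw [smoothTaylorFDeriv_polynomial]
    exact jacEntry_mem_castMat_jacEnclQ c.field j c.init hx i l
  have hAK' : ∀ z ∈ boxSet (castBox c.apriori), ∀ i l,
      smoothTaylorFDeriv hf c.order z (Pi.single l 1) i ∈ castMat c.jacRemFactor i l :=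
    fun z hz i l => by
    rw [smoothTaylorFDeriv_polynomial]
    exact jacEntry_mem_castMat_jacEnclQ c.field c.order c.apriori hz i l
  obtain ⟨J, hJ, hJV, -, N, hN, hJt⟩ := hasFDerivWithinAt_flow_intervalTest_smoothOn_local hf hK
    hh (fun t ht => mem_ratCast_stepIv ht) (castBox c.init) (castBox c.apriori) (castBox c.remBox)
    (fun j => castBox (c.coeffBox j)) (fun j => castMat (c.jacCoeffBox j))
    (castMat c.jacRemFactor) (castMat c.jacApriori) (castMat c.jacRemBox) (fun _ _ => trivial)
    (uniqueDiffOn_of_posBox hS) hE' hV' htest hEV' hAK' imatmul_le_jacRemBox htestV hu hx hτ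
    (T' := pure τ) (mem_pure_self τ)
  refine ⟨J, hJ, hJV, N, hN, ?_⟩
  simpa only [smoothTaylorFDeriv_polynomial] using hJt

/-- **`D_xφ(h, [W]) ⊆ J1`**: under `check` and `posBox S`, for any family of solutions from `W`
staying in `S`, the flow map at time `h` has within the box `W` at every `x ∈ W` a derivative with
entries in `jacEndBox`. [cite: Zgliczynski2002C1Lohner, §3 (C¹-Lohner algorithm: the enclosure of ∂φ/∂x(h,[x]))]
[cite: WalawskaWilczak2016, §2.2 Lemma 2] -/
theorem hasFDerivWithinAt_flow_step (hc : c.check = true) (hS : posBox c.apriori = true)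
    {u : (Fin n → ℝ) → ℝ → Fin n → ℝ}
    (hu : IsSolutionFamily (evalVec (fieldMv c.field)) (boxSet (castBox c.apriori))
      (boxSet (castBox c.init)) (c.step : ℝ) u)
    {x : Fin n → ℝ} (hx : x ∈ boxSet (castBox c.init)) :
    ∃ J : (Fin n → ℝ) →L[ℝ] (Fin n → ℝ),
      HasFDerivWithinAt (fun x' => u x' c.step) J (boxSet (castBox c.init)) x ∧
      ∀ i l, J (Pi.single l 1) i ∈ castMat c.jacEndBox i l := by
  obtain ⟨hK, hh, -, -⟩ := check_spec hc
  obtain ⟨J, hJ, -, N, hN, hJt⟩ := hasFDerivWithinAt_flow hc hS hu hx (τ := (c.step : ℝ))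
    ⟨hh, le_rfl⟩
  have hmem := jacTaylorSum_mem_hoeMatBox (EV := fun j => castMat (c.jacCoeffBox j))
    (NN := castMat c.jacRemBox) (K := c.order) (mem_pure_self (c.step : ℝ))
    (e := fun j => fun i l => evalVecFDeriv (taylorPoly (fieldMv c.field) j) x (Pi.single l 1) i)
    (fun j _ => (mem_matBoxSet_iff (A := castMat (c.jacCoeffBox j))).2 fun i l =>
      jacEntry_mem_castMat_jacEnclQ c.field j c.init hx i l)
    ((mem_matBoxSet_iff (A := castMat c.jacRemBox)).2 hN)
  rw [← taylorSum_apply_single', ← hJt, ← castMat_jacEndBox] at hmem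
  exact ⟨J, hJ, (mem_matBoxSet_iff (A := castMat c.jacEndBox)).1 hmem⟩

end VarStepCert

/-! ### The certificate as a `Verifier` -/

section VerifierPackaging

variable {n : ℕ}

/-- A **`C¹` step instance**: the data fixed in advance (field, order, step, initial box); the
pair of a-priori boxes `(S, VV)` is the certificate to be searched for by an untrusted stage
(predict, inflate, re-test). [cite: WalawskaWilczak2016, §2.1 (C¹ high-order enclosure)]
[cite: NedialkovJacksonCorliss1999, §5 Algorithm I] -/
structure VarInstance (n : ℕ) where
  /-- The polynomial vector field. -/
  field : Fin n → QMvPoly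
  /-- The order `K`. -/
  order : ℕ
  /-- The step size `h`. -/
  step : ℚ
  /-- The initial box `W`. -/
  init : Fin n → NonemptyInterval ℚ

/-- The claim certified for an instance: existence of the variational pair `(y, V)`,
`y' = P(y)`, `V' = DP(y) ∘ V`, `y(0) = x`, `V(0) = Id` on `[0, h]` from every `x ∈ W`.
[cite: WalawskaWilczak2016, §2.2 Lemma 2] -/
def VarInstance.Claim (I : VarInstance n) : Prop :=
  ∀ x ∈ boxSet (castBox I.init), ∃ y : ℝ → Fin n → ℝ, ∃ V' : ℝ → (Fin n → ℝ) →L[ℝ] (Fin n → ℝ),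
    y 0 = x ∧ V' 0 = 1 ∧
    (∀ t ∈ Icc 0 (I.step : ℝ),
      HasDerivWithinAt y (evalVec (fieldMv I.field) (y t)) (Icc 0 (I.step : ℝ)) t) ∧
    ∀ t ∈ Icc 0 (I.step : ℝ),
      HasDerivWithinAt V' ((evalVecFDeriv (fieldMv I.field) (y t)).comp (V' t))
        (Icc 0 (I.step : ℝ)) t

/-- The instance together with candidate a-priori boxes, as a certificate.
[cite: NedialkovJacksonCorliss1999, §5 Algorithm I] -/
def VarInstance.withBoxes (I : VarInstance n) (S : Fin n → NonemptyInterval ℚ)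
    (VV : Fin n → Fin n → NonemptyInterval ℚ) : VarStepCert n :=
  ⟨I.field, I.order, I.step, I.init, S, VV⟩

/-- **The `C¹` step verifier** in the sense of `ValidatedNumerics.Verifier`: certificates are
pairs of a-priori boxes `(S, VV)`, the checker is `VarStepCert.check`, soundness is
`VarStepCert.sound`. [cite: WalawskaWilczak2016, §2.1 (C¹ high-order enclosure) and §2.2 Lemma 2] -/
def varStepVerifier (n : ℕ) : Verifier (VarInstance n) VarInstance.Claim where
  Cert := (Fin n → NonemptyInterval ℚ) × (Fin n → Fin n → NonemptyInterval ℚ)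
  check I SV := (I.withBoxes SV.1 SV.2).check
  sound I SV h := fun _ hx => (VarStepCert.sound (c := I.withBoxes SV.1 SV.2) h hx).1

end VerifierPackaging

/-! ### Moore's Volterra example with its variational equation, replayed by the kernel -/

section MooreExample

/-- **The `C¹` step for Moore's Volterra system (8.6)** `x₁' = 2x₁(1 − x₂)`,
`x₂' = −x₂(1 − x₁)` from the point `x(0) = (1, 3)`, step `h = 0.125`, order `6`, with the
a-priori boxes `S = [0.4745, 1.1362] × [2.9012, 3.0204]` (state) and
`VV = ([0.4111, 1.1755], [−0.3283, 0.1793]; [−0.1565, 0.4407], [0.899, 1.0419])` (Jacobian,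
row-wise) found by the untrusted inflate-and-retest stage. [cite: Moore1979, §8.1 eqs. (8.6)–(8.8)]
[cite: WalawskaWilczak2016, §2.1 (C¹ high-order enclosure)] -/
def mooreVolterraVar : VarStepCert 2 where
  field := volterraField
  order := 6
  step := 1 / 8
  init := ![pure 1, pure 3]
  apriori := ![⟨(4745 / 10000, 11362 / 10000), by decide +kernel⟩,
    ⟨(29012 / 10000, 30204 / 10000), by decide +kernel⟩]
  jacApriori :=
    ![![⟨(4111 / 10000, 11755 / 10000), by decide +kernel⟩,
        ⟨(-3283 / 10000, 1793 / 10000), by decide +kernel⟩],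
      ![⟨(-1565 / 10000, 4407 / 10000), by decide +kernel⟩,
        ⟨(8990 / 10000, 10419 / 10000), by decide +kernel⟩]]

/-- The kernel accepts the `C¹` certificate: the state HOE test and the variational HOE test both
hold in exact rational interval arithmetic. [cite: WalawskaWilczak2016, §2.1 (C¹ high-order enclosure)]
[cite: Moore1979, §8.1 eq. (8.10)] -/
theorem mooreVolterraVar_check : mooreVolterraVar.check = true := by
  decide +kernel

/-- The a-priori state box is non-degenerate. [cite: Neumaier1991, §3.1 (int A)] -/
theorem mooreVolterraVar_posBox : posBox mooreVolterraVar.apriori = true := by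
  decide +kernel

/-- The certified Jacobian end box is contained in
`([0.5725, 0.6008], [−0.1592, −0.1394]; [0.2781, 0.2907], [0.9366, 0.9455])` (kernel computation;
row-wise). [cite: Zgliczynski2002C1Lohner, §3 (C¹-Lohner algorithm: the enclosure of ∂φ/∂x(h,[x]))] -/
theorem mooreVolterraVar_jacEndBox_le :
    matLE mooreVolterraVar.jacEndBox
      ![![⟨(5725 / 10000, 6008 / 10000), by decide +kernel⟩,
          ⟨(-1592 / 10000, -1394 / 10000), by decide +kernel⟩],
        ![⟨(2781 / 10000, 2907 / 10000), by decide +kernel⟩,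
          ⟨(9366 / 10000, 9455 / 10000), by decide +kernel⟩]] = true := by
  decide +kernel

/-- The initial point `(1, 3)` lies in the (degenerate) initial box. [cite: Moore1979, §8.1 eq. (8.6)] -/
theorem mooreVolterraVar_init_mem :
    (![1, 3] : Fin 2 → ℝ) ∈ boxSet (castBox mooreVolterraVar.init) := by
  rw [mem_boxSet_iff]
  intro i
  fin_cases i
  · show (1 : ℝ) ∈ (pure (1 : ℚ)).ratCast ℝ
    rw [ratCast_pure, Rat.cast_one]; exact mem_pure_self _
  · show (3 : ℝ) ∈ (pure (3 : ℚ)).ratCast ℝ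
    rw [ratCast_pure, Rat.cast_ofNat]; exact mem_pure_self _

/-- **Existence of the variational pair, certified by the kernel**: Volterra's system (8.6) with
`x(0) = (1, 3)` together with its variational equation `V' = Df(x(t))V`, `V(0) = Id` has a solution
on `[0, 0.125]`. [cite: WalawskaWilczak2016, §2.2 Lemma 2] [cite: Moore1979, §8.1 eqs. (8.6)–(8.8)] -/
theorem mooreVolterraVar_exists :
    ∃ y : ℝ → Fin 2 → ℝ, ∃ V' : ℝ → (Fin 2 → ℝ) →L[ℝ] (Fin 2 → ℝ), y 0 = ![1, 3] ∧ V' 0 = 1 ∧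
      (∀ t ∈ Icc (0 : ℝ) (((1 / 8 : ℚ) : ℝ)),
        HasDerivWithinAt y (evalVec (fieldMv volterraField) (y t))
          (Icc (0 : ℝ) ((1 / 8 : ℚ) : ℝ)) t) ∧
      ∀ t ∈ Icc (0 : ℝ) (((1 / 8 : ℚ) : ℝ)),
        HasDerivWithinAt V' ((evalVecFDeriv (fieldMv volterraField) (y t)).comp (V' t))
          (Icc (0 : ℝ) ((1 / 8 : ℚ) : ℝ)) t :=
  (VarStepCert.sound mooreVolterraVar_check mooreVolterraVar_init_mem).1

/-- **Enclosure of the Jacobian, certified by the kernel**: for every solution pair `(z, J)` of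
(8.6) and its variational equation from `((1, 3), Id)` on `[0, 0.125]`, `J(t)` stays in the
a-priori box `VV` and `J(0.125) = D_xφ(0.125, (1,3))` lies in the certified Jacobian end box, in
particular (row-wise) in `([0.5725, 0.6008], [−0.1592, −0.1394]; [0.2781, 0.2907],
[0.9366, 0.9455])`. [cite: Zgliczynski2002C1Lohner, §3 (C¹-Lohner algorithm: the enclosure of ∂φ/∂x(h,[x]))]
[cite: WalawskaWilczak2016, §2.1 (C¹ high-order enclosure) and §2.2 Lemma 2] -/
theorem mooreVolterraVar_jacobian {z : ℝ → Fin 2 → ℝ} {J : ℝ → (Fin 2 → ℝ) →L[ℝ] (Fin 2 → ℝ)}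
    (hz0 : z 0 = ![1, 3]) (hJ0 : J 0 = 1)
    (hz : ∀ t ∈ Icc (0 : ℝ) (((1 / 8 : ℚ) : ℝ)),
      HasDerivWithinAt z (evalVec (fieldMv volterraField) (z t)) (Icc (0 : ℝ) ((1 / 8 : ℚ) : ℝ)) t)
    (hJ : ∀ t ∈ Icc (0 : ℝ) (((1 / 8 : ℚ) : ℝ)),
      HasDerivWithinAt J ((evalVecFDeriv (fieldMv volterraField) (z t)).comp (J t))
        (Icc (0 : ℝ) ((1 / 8 : ℚ) : ℝ)) t) :
    (∀ t ∈ Icc (0 : ℝ) (((1 / 8 : ℚ) : ℝ)), ∀ i l,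
        J t (Pi.single l 1) i ∈ castMat mooreVolterraVar.jacApriori i l) ∧
      ∀ i l, J ((1 / 8 : ℚ) : ℝ) (Pi.single l 1) i ∈ castMat mooreVolterraVar.jacEndBox i l :=
  ⟨fun t ht => ((VarStepCert.sound mooreVolterraVar_check mooreVolterraVar_init_mem).2 z J hz0
      hJ0 hz hJ t ht).2.1,
    VarStepCert.mem_jacEndBox mooreVolterraVar_check mooreVolterraVar_init_mem hz0 hJ0 hz hJ⟩

end MooreExample

end Literature.Analysis.ODE
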